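import Literature.NumberTheory.Automorphic.StandardTestFunSchwartzBruhat
import Literature.NumberTheory.Automorphic.AdelicPiSchwartzBruhatFourier
import Literature.Analysis.FunctionSpaces.GaussianSchwartz
import Mathlib.Analysis.InnerProductSpace.EuclideanDist
import HarnessLib

/-!
# The Gaussian standard test function `Φ = e^{-q(z_∞)} ⊗ 𝟙_{𝒪̂ⁿ}` lies in `piSchwartzBruhat` and has `∫ Φ > 0`

Topic `NumberTheory/Automorphic`; namespace `Literature.NumberTheory.Automorphic`. One definition
(`gaussArchTestFun`, an archimedean Gaussian) and theorems. The Rankin–Selberg method towards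
Arthur–Clozel's (2.3) (`JacquetShalika1981_partialPairL_pole_of_eq_conj_of_unfolding`,
`RankinSelbergResidueDatum`) needs a test function `Φ` on `𝔸_Kⁿ` which is (a) of the standard form
`Φ_∞ ⊗ 𝟙_{𝒪̂ⁿ}` of `RankinSelbergTorusIntegral` (`standardTestFun`, Jacquet–Shalika (1981), (5.1); the
real-point machinery of the tree is written for it), (b) in the Fourier-stable Schwartz–Bruhat class
`piSchwartzBruhat K (Fin n)` of `AdelicPiSchwartzBruhatFourier` (Poisson summation, the pole of the
Eisenstein series: `MirabolicEisensteinResidue`, `RankinSelbergIntegralResidue`), and (c) with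
`Φ̂(0) = ∫ Φ ≠ 0` (the residue `c_D V Φ̂(0) ‖φ‖² / n` must not vanish). Cogdell (2004), §2.3 takes a
Gaussian at infinity; here `Φ_∞(z) = exp(-‖T z_∞‖²)` with `T` a linear isomorphism of `(K ⊗ ℝ)ⁿ` onto a
Euclidean space (`toEuclidean`), so that `Φ_∞` is literally the pull-back of the Gaussian Schwartz
function `Literature.Analysis.FunctionSpaces.gaussianSchwartz` (`GaussianSchwartz`):

* `indicator_integralFiniteAdeleVec_mem_schwartzBruhat` — `𝟙_{𝒪̂ⁿ}` is Schwartz–Bruhat on `(𝔸_K^∞)ⁿ`;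
* `ofReal_standardTestFun_eq_tensor`, `ofReal_standardTestFun_mem_piSchwartzBruhat` — for any
  `Φ_∞` that is a Schwartz function of `z_∞ ∈ (K ⊗ ℝ)ⁿ`, `(standardTestFun n K Φ_∞ : ℂ) = Φ_∞ ⊗ 𝟙_{𝒪̂ⁿ}`
  is a pure tensor of `piSchwartzBruhat K (Fin n)`;
* `gaussArchTestFun` (**definition**), `gaussArchTestFun_pos`, `continuous_gaussArchTestFun`,
  `exists_schwartzMap_gaussArchTestFun` — the Gaussian and its Schwartz structure;
* `standardTestFun_gauss_mem_piSchwartzBruhat`, `standardTestFun_gauss_nonneg`,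
  `integral_standardTestFun_gauss_pos`, `integral_ofReal_standardTestFun_gauss_ne_zero` — (b) and (c)
  for the Gaussian standard test function and every additive Haar measure on `𝔸_Kⁿ`.

## References

* J. W. Cogdell, *Analytic theory of L-functions for GL_n*, in *An Introduction to the Langlands
  Program* (2004), §2.3 [CogdellAnalyticTheory2004].
* H. Jacquet, J. A. Shalika, Amer. J. Math. 103 (1981), §5, (5.1) [JacquetShalikaAJM1981].
-/

noncomputable section

open scoped NNReal Classical
open NumberField NumberField.mixedEmbedding IsDedekindDomain Set MeasureTheory

namespace Literature.NumberTheory.Automorphic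

section Tensor

variable (n : ℕ) (K : Type) [Field K] [NumberField K]

/-- **`𝟙_{𝒪̂ⁿ}` is a Schwartz–Bruhat function on `(𝔸_K^∞)ⁿ`** (locally constant: `𝒪̂ⁿ` is clopen;
compactly supported: `𝒪̂ⁿ` is compact). [folklore] -/
theorem indicator_integralFiniteAdeleVec_mem_schwartzBruhat :
    {z : Fin n → FiniteAdeleRing (𝓞 K) K | ∀ (i : Fin n) (w : HeightOneSpectrum (𝓞 K)),
        z i w ∈ w.adicCompletionIntegers K}.indicator (1 : (Fin n → FiniteAdeleRing (𝓞 K) K) → ℂ) ∈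
      SchwartzBruhat (Fin n → FiniteAdeleRing (𝓞 K) K) := by
  set U := {z : Fin n → FiniteAdeleRing (𝓞 K) K | ∀ (i : Fin n) (w : HeightOneSpectrum (𝓞 K)),
    z i w ∈ w.adicCompletionIntegers K} with hU
  have hUc : IsClopen U := isClopen_integralFiniteAdeleVec n K
  rw [mem_schwartzBruhat_iff]
  constructor
  · rw [IsLocallyConstant.iff_exists_open]
    intro y
    by_cases hy : y ∈ U
    · exact ⟨U, hUc.isOpen, hy, fun z hz => by
        simp only [Set.indicator_of_mem hz, Set.indicator_of_mem hy, Pi.one_apply]⟩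
    · exact ⟨Uᶜ, hUc.compl.isOpen, hy, fun z hz => by
        rw [Set.indicator_of_notMem hz, Set.indicator_of_notMem hy]⟩
  · exact HasCompactSupport.intro (isCompact_integralFiniteAdeleVec n K) fun y hy => Set.indicator_of_notMem hy _

variable {n K}

/-- If `(Φ_∞ z : ℂ) = Ψ(e(z))` for a Schwartz function `Ψ` on `(K ⊗ ℝ)ⁿ` (read through
`K_∞ ≃ K ⊗ ℝ` coordinatewise), then `(standardTestFun n K Φ_∞ y : ℂ) = Ψ(y_∞) · 𝟙_{𝒪̂ⁿ}(y_f)` in the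
coordinates `piArch`, `piFinite` of `AdelicPiSchwartzBruhatFourier`. [folklore] -/
theorem ofReal_standardTestFun_eq_tensor {Φinf : (Fin n → InfiniteAdeleRing K) → ℝ}
    {Ψ : SchwartzMap (Fin n → mixedSpace K) ℂ}
    (hΦinf : ∀ z : Fin n → InfiniteAdeleRing K,
      ((Φinf z : ℝ) : ℂ) = Ψ fun i => InfiniteAdeleRing.ringEquiv_mixedSpace K (z i))
    (y : Fin n → AdeleRing (𝓞 K) K) :
    ((standardTestFun n K Φinf y : ℝ) : ℂ) =
      Ψ (piArch K (Fin n) y) *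
        {z : Fin n → FiniteAdeleRing (𝓞 K) K | ∀ (i : Fin n) (w : HeightOneSpectrum (𝓞 K)),
            z i w ∈ w.adicCompletionIntegers K}.indicator (1 : (Fin n → FiniteAdeleRing (𝓞 K) K) → ℂ)
          (piFinite K (Fin n) y) := by
  unfold standardTestFun
  by_cases h : ∀ (i : Fin n) (w : HeightOneSpectrum (𝓞 K)), (y i).2 w ∈ w.adicCompletionIntegers K
  · have hmem : piFinite K (Fin n) y ∈ {z : Fin n → FiniteAdeleRing (𝓞 K) K |
        ∀ (i : Fin n) (w : HeightOneSpectrum (𝓞 K)), z i w ∈ w.adicCompletionIntegers K} := h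
    rw [if_pos h, hΦinf, Set.indicator_of_mem hmem, Pi.one_apply, mul_one]
    rfl
  · have hmem : piFinite K (Fin n) y ∉ {z : Fin n → FiniteAdeleRing (𝓞 K) K |
        ∀ (i : Fin n) (w : HeightOneSpectrum (𝓞 K)), z i w ∈ w.adicCompletionIntegers K} := h
    rw [if_neg h, Set.indicator_of_notMem hmem, mul_zero, Complex.ofReal_zero]

/-- **`Φ_∞ ⊗ 𝟙_{𝒪̂ⁿ} ∈ piSchwartzBruhat K (Fin n)`** whenever `Φ_∞` is a Schwartz function of
`z_∞ ∈ (K ⊗ ℝ)ⁿ` (a pure tensor, `tensor_mem_piSchwartzBruhat`). [folklore] -/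
theorem ofReal_standardTestFun_mem_piSchwartzBruhat {Φinf : (Fin n → InfiniteAdeleRing K) → ℝ}
    {Ψ : SchwartzMap (Fin n → mixedSpace K) ℂ}
    (hΦinf : ∀ z : Fin n → InfiniteAdeleRing K,
      ((Φinf z : ℝ) : ℂ) = Ψ fun i => InfiniteAdeleRing.ringEquiv_mixedSpace K (z i)) :
    (fun y => ((standardTestFun n K Φinf y : ℝ) : ℂ)) ∈ piSchwartzBruhat K (Fin n) := by
  have heq : (fun y => ((standardTestFun n K Φinf y : ℝ) : ℂ)) = fun y =>
      Ψ (piArch K (Fin n) y) *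
        {z : Fin n → FiniteAdeleRing (𝓞 K) K | ∀ (i : Fin n) (w : HeightOneSpectrum (𝓞 K)),
            z i w ∈ w.adicCompletionIntegers K}.indicator (1 : (Fin n → FiniteAdeleRing (𝓞 K) K) → ℂ)
          (piFinite K (Fin n) y) :=
    funext (ofReal_standardTestFun_eq_tensor hΦinf)
  rw [heq]
  exact tensor_mem_piSchwartzBruhat Ψ (indicator_integralFiniteAdeleVec_mem_schwartzBruhat n K)

end Tensor

/-! ### The Gaussian archimedean factor -/

section Gauss

variable (n : ℕ) (K : Type) [Field K] [NumberField K]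

/-- **The archimedean Gaussian `Φ_∞(z) = exp(-‖T z_∞‖²)`** on `K_∞ⁿ`: `z_∞` read in `(K ⊗ ℝ)ⁿ`
(`InfiniteAdeleRing.ringEquiv_mixedSpace` coordinatewise) and `T = toEuclidean` a linear isomorphism onto
the Euclidean space of the same dimension, so that `Φ_∞` is the pull-back of the Gaussian
`x ↦ e^{-‖x‖²}` of a Euclidean space (positive, continuous, Schwartz). Cogdell (2004), §2.3 (a Gaussian at
infinity; any positive Schwartz function serves). [folklore] -/
def gaussArchTestFun (z : Fin n → InfiniteAdeleRing K) : ℝ :=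
  Real.exp (-‖toEuclidean (E := Fin n → mixedSpace K)
    (fun i => InfiniteAdeleRing.ringEquiv_mixedSpace K (z i))‖ ^ 2)

/-- `Φ_∞ > 0`. [folklore] -/
theorem gaussArchTestFun_pos (z : Fin n → InfiniteAdeleRing K) : 0 < gaussArchTestFun n K z :=
  Real.exp_pos _

/-- `Φ_∞` is continuous. [folklore] -/
theorem continuous_gaussArchTestFun : Continuous (gaussArchTestFun n K) := by
  unfold gaussArchTestFun
  refine Real.continuous_exp.comp (continuous_neg.comp ((continuous_norm.comp ?_).pow 2))
  exact (toEuclidean (E := Fin n → mixedSpace K)).continuous.comp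
    (continuous_pi fun i => (continuous_ringEquiv_mixedSpace K).comp (continuous_apply i))

/-- **`Φ_∞` is a Schwartz function of `z_∞`**: `(Φ_∞ z : ℂ) = Ψ(e(z))` with
`Ψ = gaussianSchwartz ∘ toEuclidean ∈ 𝓢((K ⊗ ℝ)ⁿ, ℂ)` (`SchwartzMap.compCLMOfContinuousLinearEquiv`).
[folklore] -/
theorem exists_schwartzMap_gaussArchTestFun :
    ∃ Ψ : SchwartzMap (Fin n → mixedSpace K) ℂ, ∀ z : Fin n → InfiniteAdeleRing K,
      ((gaussArchTestFun n K z : ℝ) : ℂ) = Ψ fun i => InfiniteAdeleRing.ringEquiv_mixedSpace K (z i) := by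
  refine ⟨SchwartzMap.compCLMOfContinuousLinearEquiv ℂ (toEuclidean (E := Fin n → mixedSpace K))
    (Literature.Analysis.FunctionSpaces.gaussianSchwartz _ 1), fun z => ?_⟩
  rw [SchwartzMap.compCLMOfContinuousLinearEquiv_apply, Function.comp_apply,
    Literature.Analysis.FunctionSpaces.gaussianSchwartz_apply one_pos, neg_mul, one_mul]
  rfl

/-- **The Gaussian standard test function lies in `piSchwartzBruhat K (Fin n)`.**
[cite: CogdellAnalyticTheory2004, §2.3] -/
theorem standardTestFun_gauss_mem_piSchwartzBruhat :
    (fun y => ((standardTestFun n K (gaussArchTestFun n K) y : ℝ) : ℂ)) ∈ piSchwartzBruhat K (Fin n) := by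
  obtain ⟨Ψ, hΨ⟩ := exists_schwartzMap_gaussArchTestFun n K
  exact ofReal_standardTestFun_mem_piSchwartzBruhat hΨ

/-- The Gaussian standard test function is non-negative. [folklore] -/
theorem standardTestFun_gauss_nonneg (y : Fin n → AdeleRing (𝓞 K) K) :
    0 ≤ standardTestFun n K (gaussArchTestFun n K) y :=
  standardTestFun_nonneg (fun z => (gaussArchTestFun_pos n K z).le) y

/-- The Gaussian standard test function is positive on the open box `{y | y_f ∈ 𝒪̂ⁿ}`. [folklore] -/
theorem standardTestFun_gauss_pos_of_mem {y : Fin n → AdeleRing (𝓞 K) K}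
    (hy : ∀ (i : Fin n) (w : HeightOneSpectrum (𝓞 K)), (y i).2 w ∈ w.adicCompletionIntegers K) :
    0 < standardTestFun n K (gaussArchTestFun n K) y := by
  unfold standardTestFun
  rw [if_pos hy]
  exact gaussArchTestFun_pos n K _

variable [MeasurableSpace (AdeleRing (𝓞 K) K)] [BorelSpace (AdeleRing (𝓞 K) K)]

/-- **`∫ Φ dμ > 0` for the Gaussian standard test function** and every additive Haar measure `μ` on
`𝔸_Kⁿ`: `Φ ≥ 0` is integrable (`piSchwartzBruhat`, `integrable_of_mem_piSchwartzBruhat`) and positive on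
the non-empty open set `{y | y_f ∈ 𝒪̂ⁿ}`, which has positive Haar measure. [folklore] -/
theorem integral_standardTestFun_gauss_pos (μ : Measure (Fin n → AdeleRing (𝓞 K) K)) [μ.IsAddHaarMeasure] :
    0 < ∫ y, standardTestFun n K (gaussArchTestFun n K) y ∂μ := by
  set Φ : (Fin n → AdeleRing (𝓞 K) K) → ℝ := standardTestFun n K (gaussArchTestFun n K) with hΦ
  have hintC : Integrable (fun y => ((Φ y : ℝ) : ℂ)) μ :=
    integrable_of_mem_piSchwartzBruhat (ν := μ) (standardTestFun_gauss_mem_piSchwartzBruhat n K)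
  have hint : Integrable Φ μ := by
    have h := hintC.re
    simpa only [RCLike.re_to_complex, Complex.ofReal_re] using h
  rw [integral_pos_iff_support_of_nonneg (fun y => standardTestFun_gauss_nonneg n K y) hint]
  -- the open box `{y | y_f ∈ 𝒪̂ⁿ}` lies in the support
  set U : Set (Fin n → AdeleRing (𝓞 K) K) := {y | ∀ (i : Fin n) (w : HeightOneSpectrum (𝓞 K)),
    (y i).2 w ∈ w.adicCompletionIntegers K} with hU
  have hUo : IsOpen U :=
    (isClopen_integralFiniteAdeleVec n K).isOpen.preimage
      (continuous_pi fun i => continuous_snd.comp (continuous_apply i))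
  have hU0 : (0 : Fin n → AdeleRing (𝓞 K) K) ∈ U := fun i w => by
    have h0 : ((0 : Fin n → AdeleRing (𝓞 K) K) i).2 w = 0 := rfl
    rw [h0]
    exact zero_mem _
  have hUsupp : U ⊆ Function.support Φ := fun y hy =>
    (standardTestFun_gauss_pos_of_mem n K hy).ne'
  exact (hUo.measure_pos μ ⟨0, hU0⟩).trans_le (measure_mono hUsupp)

/-- **`Φ̂(0) = ∫ Φ ≠ 0`** for the (complexified) Gaussian standard test function — the hypothesis
`∫ Φ dμ ≠ 0` of `CuspidalAutomorphicRepGL.exists_residue_datum` /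
`JacquetShalika1981_partialPairL_pole_of_eq_conj_of_unfolding`. [cite: CogdellAnalyticTheory2004, §2.3] -/
theorem integral_ofReal_standardTestFun_gauss_ne_zero (μ : Measure (Fin n → AdeleRing (𝓞 K) K))
    [μ.IsAddHaarMeasure] :
    ∫ y, ((standardTestFun n K (gaussArchTestFun n K) y : ℝ) : ℂ) ∂μ ≠ 0 := by
  rw [integral_complex_ofReal, Complex.ofReal_ne_zero]
  exact (integral_standardTestFun_gauss_pos n K μ).ne'

end Gauss

end Literature.NumberTheory.Automorphic
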